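import Summits.BirchSwinnertonDyer.BirchSwinnertonDyer.Theorems.PrintCf2SplitBadTwoWeakLeopoldtStagesTotallyComplex
import Literature.NumberTheory.IwasawaTheory.Greenberg2006.WeakLeopoldtAboveCyclotomicProof
import HarnessLib

/-!
# Weak Leopoldt above `K′K̃_∞(μ_{p^∞})` for a `ℤ_p^m`-extension `K̃_∞`, `p ≠ 2 ∨ K` totally complex
# (crux `SplitBadTwoRankOneOfFacts`, stmt-BirchSwinnertonDyer-20368; road (γ) at `p = 2`, input hH2₂)

Cell `bsd-print-cf2`, width seat `bsd-line-cf2-p1-w2` gen 12, lane S3n′ (`stub_pseudoNullFinite_two`,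
skeleton v10.6).  Sequel of `…WeakLeopoldtStagesTotallyComplex` (`subsingleton_H2_above_muInfty`:
`H²(Gal(K_Σ/K′(μ_{p^∞})), D) = 0` for every open `U₀ ≥ N_S`, parity hypothesis
`p ≠ 2 ∨ IsTotallyComplex K`).  Here the limit over the finite multi-layers `K̃_j` of a
`ℤ_p^m`-extension `K̃_∞ = K̄^{⋂ᵢ ker κᵢ}` — the argument of the tree's
`Greenberg2006.above_cyclotomic_of_cyclotomic` ([NQD84] Thm. 2.2: `Gal(K_Σ/K′K̃_∞(μ_{p^∞})) =
⋂ⱼ Gal(K_Σ/K′K̃_j(μ_{p^∞}))` and Serre I §2.2 Prop. 8 in vanishing form,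
`subsingleton_H2_trivial_iInf_of_forall`) — gives:

* **`subsingleton_H2_above_tower_muInfty`** — for a number field `K`, a prime `p` with
  `p ≠ 2 ∨ IsTotallyComplex K`, a finite `S ⊇ {v ∣ p}`, `κ : Fin m → ZpExtension K p`, an open
  `U₀ ≥ N_S` (`K′ = K̄^{U₀} ⊆ K_Σ`) and a discrete `D ≃+ ℚ_p/ℤ_p` with the trivial action (inert `R`):
  the continuous `H²` of `galoisGroupAbove S ((U₀ ⊓ multiZpKer p κ) ⊓ ⨅ₖ ker χ̄_{p^k}) =
  Gal(K_Σ/K′K̃_∞(μ_{p^∞}))` is a subsingleton.  NO cyclotomic-containment clause and NO descent: the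
  `p`-power roots of unity are adjoined explicitly (at `p = 2` the consumer descends by Serre I §2.4
  Prop. 9 from `K̃_∞K_θ(i)`, sequel `…H2AboveKilledAtTwo`).

Theorems only; no definition, no named fact, no `sorry`, no instance.  HONEST FRAMING: Iwasawa 1973 /
NSW (10.3.25) / NQD84 Thm. 2.2 in the tree's currency; closes nothing by itself (`--supports`); no
summit statement / BSD / the crux is proved here.

References: [NguyenQuangDo1984] Thm. 2.2; [NeukirchSchmidtWingberg2008] (10.3.25);
[SerreGaloisCohomology1997] I §2.2 Prop. 8; [Greenberg2006] pp. 341–344; [Washington1997] §13.1.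
-/

noncomputable section

open scoped Classical
open NumberField IsDedekindDomain Field
open Literature.NumberTheory.GaloisRepresentations
open Literature.NumberTheory.EllipticCurves (ZpExtension)
open Literature.NumberTheory.IwasawaTheory Literature.NumberTheory.IwasawaTheory.Greenberg2006
open _root_.TopRep _root_.ContRepresentation _root_.ContinuousCohomology

set_option linter.dupNamespace false -- `Summit.BirchSwinnertonDyer.BirchSwinnertonDyer` (summit = problem) is the tree's layout

namespace Summit.BirchSwinnertonDyer.BirchSwinnertonDyer.Theorems.PrintCf2.WeakLeopoldtTwo

variable {K : Type} [Field K] [NumberField K] (p : ℕ) [hp : Fact p.Prime]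
  (S : Set (HeightOneSpectrum (𝓞 K)))

/-- Transport of the vanishing `H²(H, D) = 0` (trivial coefficients) along an EQUALITY of subgroups
`H₁ = H₂` of a topological group (the tree's private `subsingleton_H2_trivial_subgroup_congr'`).
[folklore] -/
theorem subsingleton_H2_trivial_congr {G : Type} [Group G] [TopologicalSpace G]
    [IsTopologicalGroup G] {R : Type} [CommRing R] [TopologicalSpace R] [IsTopologicalRing R]
    {D : Type} [AddCommGroup D] [Module R D] [TopologicalSpace D] [DiscreteTopology D]
    [ContinuousSMul R D] {H₁ H₂ : Subgroup G} (e : H₁ = H₂)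
    (h : Subsingleton ((ContinuousRep.trivial H₁ R D).H 2)) :
    Subsingleton ((ContinuousRep.trivial H₂ R D).H 2) := by
  subst e
  exact h

omit hp in
/-- A group additively isomorphic to `ℚ_p/ℤ_p` is torsion. [folklore] -/
theorem isTorsion_of_addEquiv_quotientSubring [Fact p.Prime] {D : Type} [AddCommGroup D]
    (hD : Nonempty (D ≃+ ℚ_[p] ⧸ (PadicInt.subring p).toAddSubgroup)) : AddMonoid.IsTorsion D := by
  intro d
  obtain ⟨n, hn⟩ := exists_pow_nsmul_eq_zero_of_addEquiv p hD d
  exact isOfFinAddOrder_iff_nsmul_eq_zero.mpr ⟨p ^ n, pow_pos (Fact.out : p.Prime).pos n, hn⟩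

omit [NumberField K] hp in
/-- Lattice identity behind the limit: `⨅ⱼ ((U₀ ⊓ Vⱼ) ⊓ C) = (U₀ ⊓ ⨅ⱼ Vⱼ) ⊓ C` (`ℕ`-indexed). [folklore] -/
theorem iInf_inf_inf_eq (U₀ C : Subgroup (absoluteGaloisGroup K))
    (V : ℕ → Subgroup (absoluteGaloisGroup K)) :
    (⨅ j, (U₀ ⊓ V j) ⊓ C) = (U₀ ⊓ ⨅ j, V j) ⊓ C := by
  refine le_antisymm (fun σ hσ ↦ ?_) (le_iInf fun j ↦
    inf_le_inf_right C (inf_le_inf_left U₀ (iInf_le V j)))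
  rw [Subgroup.mem_iInf] at hσ
  refine Subgroup.mem_inf.mpr ⟨Subgroup.mem_inf.mpr ⟨(Subgroup.mem_inf.mp (Subgroup.mem_inf.mp
    (hσ 0)).1).1, ?_⟩, (Subgroup.mem_inf.mp (hσ 0)).2⟩
  rw [Subgroup.mem_iInf]
  exact fun j ↦ (Subgroup.mem_inf.mp (Subgroup.mem_inf.mp (hσ j)).1).2

/-- **`H²(Gal(K_Σ/K′K̃_∞(μ_{p^∞})), D) = 0` for `p ≠ 2 ∨ K` totally complex** — weak Leopoldt above
the compositum of a `ℤ_p^m`-extension `K̃_∞ = K̄^{⋂ᵢ ker κᵢ}`, a finite `K′ = K̄^{U₀} ⊆ K_Σ` (`U₀ ≥ N_S`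
open) and ALL `p`-power roots of unity, for a discrete `D ≃+ ℚ_p/ℤ_p` with the trivial action over
any inert coefficient ring: the continuous `H²` of
`galoisGroupAbove S ((U₀ ⊓ multiZpKer p κ) ⊓ ⨅ₖ ker χ̄_{p^k})` is a subsingleton.  Proof: the stages
`W_j = (U₀ ∩ V_j) ∩ ⋂ₖ ker χ̄_{p^k}` (`V_j` the open multi-layer subgroups, `⋂ⱼ V_j = ⋂ᵢ ker κᵢ`)
have vanishing `H²` by `subsingleton_H2_above_muInfty` at the open `U₀ ∩ V_j ⊇ N_S`; pass to the
intersection (`subsingleton_H2_trivial_iInf_of_forall`, torsion coefficients) and use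
`galoisGroupAbove S (⋂ⱼ W_j) = ⋂ⱼ galoisGroupAbove S (W_j)` (`galoisGroupAbove_iInf`).
[cite: NguyenQuangDo1984, Thm. 2.2 (proof)] [cite: SerreGaloisCohomology1997, I §2.2 Prop. 8]
[cite: NeukirchSchmidtWingberg2008, (10.3.25)] [cite: Greenberg2006, pp. 343–344] -/
theorem subsingleton_H2_above_tower_muInfty (hk2 : p ≠ 2 ∨ IsTotallyComplex K)
    (hS : ∀ v : HeightOneSpectrum (𝓞 K), ((p : ℕ) : 𝓞 K) ∈ v.asIdeal → v ∈ S)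
    {m : ℕ} (κ : Fin m → ZpExtension K p)
    (U₀ : Subgroup (absoluteGaloisGroup K)) (hU₀ : IsOpen (U₀ : Set (absoluteGaloisGroup K)))
    (hN : ramificationSubgroup K S ≤ U₀)
    {R : Type} [CommRing R] [TopologicalSpace R] [IsTopologicalRing R]
    {D : Type} [AddCommGroup D] [Module R D] [TopologicalSpace D] [DiscreteTopology D]
    [ContinuousSMul R D] (hD : Nonempty (D ≃+ ℚ_[p] ⧸ (PadicInt.subring p).toAddSubgroup)) :
    Subsingleton ((ContinuousRep.trivial (galoisGroupAbove S
      ((U₀ ⊓ multiZpKer p κ) ⊓ ⨅ k : ℕ, (modNCyclotomicCharacter K (p ^ k)).ker)) R D).H 2) := by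
  -- the stages `W_j = (U₀ ∩ V_j) ∩ ⋂ₖ F_k`
  set C : Subgroup (absoluteGaloisGroup K) := ⨅ k : ℕ, (modNCyclotomicCharacter K (p ^ k)).ker
    with hC
  set W : ℕ → Subgroup (absoluteGaloisGroup K) :=
    fun j ↦ (U₀ ⊓ ⨅ i, (κ i).layerSubgroup j) ⊓ C with hW
  have hNC : ramificationSubgroup K S ≤ C :=
    le_iInf fun k ↦ ramificationSubgroup_le_ker_modNCyclotomicCharacter p S hS k
  have hNV : ∀ j, ramificationSubgroup K S ≤ U₀ ⊓ ⨅ i, (κ i).layerSubgroup j := fun j ↦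
    le_inf hN ((ramificationSubgroup_le_multiZpKer S p κ hS).trans (multiZpKer_le_multiLayer κ j))
  have hNW : ∀ j, ramificationSubgroup K S ≤ W j := fun j ↦ le_inf (hNV j) hNC
  have hWanti : Antitone W := fun j k hjk ↦
    inf_le_inf_right _ (inf_le_inf_left _ (multiLayer_antitone κ hjk))
  have hCcl : IsClosed ((C : Subgroup (absoluteGaloisGroup K)) : Set (absoluteGaloisGroup K)) := by
    rw [hC, Subgroup.coe_iInf]
    exact isClosed_iInter fun k ↦
      Subgroup.isClosed_of_isOpen _ (isOpen_ker_modNCyclotomicCharacter p k)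
  have hWcl : ∀ j, IsClosed ((W j : Subgroup (absoluteGaloisGroup K)) : Set (absoluteGaloisGroup K)) :=
    fun j ↦ ((Subgroup.isClosed_of_isOpen U₀ hU₀).inter
      (Subgroup.isClosed_of_isOpen _ (isOpen_multiLayer κ j))).inter hCcl
  -- each stage: `H²` vanishes above `K′K̃_j(μ_{p^∞})` (open `U₀ ∩ V_j ⊇ N_S`)
  have hstage : ∀ j, Subsingleton ((ContinuousRep.trivial (galoisGroupAbove S (W j)) R D).H 2) :=
    fun j ↦ subsingleton_H2_above_muInfty p S hk2 hS (U₀ ⊓ ⨅ i, (κ i).layerSubgroup j)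
      (hU₀.inter (isOpen_multiLayer κ j)) (hNV j) (R := R) hD
  -- the limit lemma in the profinite group `G_{K,S}`
  haveI : TotallyDisconnectedSpace (GaloisGroupUnramifiedOutside K S) :=
    totallyDisconnectedSpace_galoisGroupUnramifiedOutside S
  have hlim : Subsingleton
      ((ContinuousRep.trivial (⨅ j, galoisGroupAbove S (W j) :
        Subgroup (GaloisGroupUnramifiedOutside K S)) R D).H 2) :=
    subsingleton_H2_trivial_iInf_of_forall (isTorsion_of_addEquiv_quotientSubring p hD)
      (fun j ↦ galoisGroupAbove S (W j)) (fun j k hjk ↦ Subgroup.map_mono (hWanti hjk))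
      (fun j ↦ isClosed_galoisGroupAbove S (W j) (hWcl j)) hstage
  -- `Gal(K_Σ/K′K̃_∞(μ_{p^∞})) = ⋂ⱼ Gal(K_Σ/K′K̃_j(μ_{p^∞}))`
  have heq : (⨅ j, galoisGroupAbove S (W j)) =
      galoisGroupAbove S ((U₀ ⊓ multiZpKer p κ) ⊓ C) := by
    rw [← galoisGroupAbove_iInf S W hNW, hW, iInf_inf_inf_eq, iInf_multiLayer κ]
  exact subsingleton_H2_trivial_congr heq hlim

end Summit.BirchSwinnertonDyer.BirchSwinnertonDyer.Theorems.PrintCf2.WeakLeopoldtTwo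

end
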